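import Summits.SmoothPoincare4.SmoothPoincare4.Theorems.CongruenceShadowsGriffithsHandlebodyExtensionCoverLiftB
import Summits.SmoothPoincare4.SmoothPoincare4.Theorems.CongruenceShadowsGriffithsHandlebodyExtensionCoverMap
import HarnessLib

/-!
# SmoothPoincare4 / CongruenceShadows — `GriffithsHandlebodyExtension` (item stmt-SmoothPoincare4-15190): lifting the boundary diffeomorphism, III — the planar lift `τ̂` (E2)

Support file (`--supports` stmt-SmoothPoincare4-15190) of the homothety-cover proof of the genus-one
clause (E) of Griffiths' handlebody extension theorem — *every self-diffeomorphism of the Heegaard torus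
`∂V` of the round solid torus fixing the base point and acting trivially on `π₁(∂V)` extends to a
self-diffeomorphism of `V`* (hypothesis `hE` of
`Literature.Topology.FourManifolds.RoundSolidTorusModel.diffeoExtends_of_map_ker_eq_ker_of_forall_diffeoExtends`).
See the module docstring of `…CoverDefs` for the whole line (E1–E6) and the notation
(`τ̂`, `δ_λ`, `ρ`, `χ`, `f`, `Δ^(c)`, `α`, `L`, `M`, `Ψ̂`, `ẽ_c`).

This part (E2, planar form): log-polar coordinates `Epol (s, φ) = exp (s/κ) (cos φ, sin φ)` with `κ log λ = 2π`, the planar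
lift `τ̂ = Epol ∘ liftT ∘ polarLog` extended by `0 ↦ 0`: well defined, `δ_λ`-equivariant, with inverse the lift of
`τV⁻¹`, and `covMap (τ̂ y, 0) = τV (covMap (y, 0))` (`hlift_tauHat`).
-/

-- the registered namespace `Summit.SmoothPoincare4.SmoothPoincare4.Theorems` repeats a component
set_option linter.dupNamespace false

noncomputable section

namespace Summit.SmoothPoincare4.SmoothPoincare4.Theorems

namespace HomothetyCover

open Set Function Metric Filter
open scoped Topology ContDiff

section Lift

open Literature.Topology.FourManifolds Literature.Topology.FourManifolds.RoundSolidTorusModel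
open Complex (I)
open scoped Manifold
variable (τV : (𝓡∂ 3).boundary RoundSolidTorus ≃ₘ⟮𝓡 2, 𝓡 2⟯ (𝓡∂ 3).boundary RoundSolidTorus)
variable {τV}
variable (τV)
variable {τV}

section Planar

open Literature.Topology.Euclidean
variable (lam : ℝ)

/-- The exp-polar covering `ℝ × ℝ → ℝ² ∖ 0`, `(θ, φ) ↦ e^{θ/κ} (cos φ, sin φ)`: longitude lifts
`θ` go to the radial direction (one turn = one homothety `λ`), meridian lifts `φ` to the angle. -/
def Epol (x : ℝ × ℝ) : E2 := Real.exp (x.1 / kap lam) • !₂[Real.cos x.2, Real.sin x.2]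

/-- The complex number `y₀ + i y₁` of a point of the plane. -/
def zOf (y : E2) : ℂ := (y 0 : ℂ) + (y 1 : ℂ) * I

/-- The principal (discontinuous) inverse of `Epol`: `y ↦ (κ log ‖y‖, arg (y₀ + i y₁))`. -/
def polarLog (y : E2) : ℝ × ℝ := (kap lam * Real.log ‖y‖, Complex.arg (zOf y))

/-- A branch of the inverse of `Epol` adapted to the ray of angle `φ₀`. -/
def polarLogAt (φ₀ : ℝ) (y : E2) : ℝ × ℝ :=
  (kap lam * Real.log ‖y‖, φ₀ + Complex.arg (zOf y * Complex.exp (-((φ₀ : ℂ) * I))))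

variable {lam}

/-- First coordinate of the log-polar parametrisation `Epol`. -/
@[simp] theorem Epol_apply_zero (x : ℝ × ℝ) : Epol lam x 0 = Real.exp (x.1 / kap lam) * Real.cos x.2 := by
  simp [Epol]

/-- Second coordinate of the log-polar parametrisation `Epol`. -/
@[simp] theorem Epol_apply_one (x : ℝ × ℝ) : Epol lam x 1 = Real.exp (x.1 / kap lam) * Real.sin x.2 := by
  simp [Epol]

/-- `(cos φ, sin φ)` is a unit vector. -/
theorem norm_cos_sin (φ : ℝ) : ‖(!₂[Real.cos φ, Real.sin φ] : E2)‖ = 1 := by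
  rw [EuclideanSpace.norm_eq, Fin.sum_univ_two]
  simp only [Matrix.cons_val_zero, Matrix.cons_val_one, Real.norm_eq_abs, sq_abs,
    Real.cos_sq_add_sin_sq, Real.sqrt_one]

/-- `‖Epol (s, φ)‖ = exp (s/κ)`. -/
theorem norm_Epol (x : ℝ × ℝ) : ‖Epol lam x‖ = Real.exp (x.1 / kap lam) := by
  rw [Epol, norm_smul, norm_cos_sin, mul_one, Real.norm_eq_abs, abs_of_pos (Real.exp_pos _)]

/-- `Epol` misses the origin. -/
theorem Epol_ne_zero (x : ℝ × ℝ) : Epol lam x ≠ 0 := by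
  intro h
  have := norm_Epol (lam := lam) x
  rw [h, norm_zero] at this
  exact (Real.exp_pos _).ne this

/-- `Epol` read as a complex number: `exp (s/κ) · exp (iφ)`. -/
theorem zOf_Epol (x : ℝ × ℝ) :
    zOf (Epol lam x) = (Real.exp (x.1 / kap lam) : ℝ) * Complex.exp ((x.2 : ℂ) * I) := by
  rw [zOf, Epol_apply_zero, Epol_apply_one, Complex.exp_mul_I]
  push_cast
  ring

/-- The identification `zOf : E2 → ℂ` is norm-preserving. -/
theorem norm_zOf (y : E2) : ‖zOf y‖ = ‖y‖ := by
  have h1 : ‖zOf y‖ ^ 2 = y 0 ^ 2 + y 1 ^ 2 := by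
    rw [Complex.sq_norm, Complex.normSq_apply, zOf]; simp; ring
  have h2 := norm_sq_snd_eq y
  nlinarith [norm_nonneg (zOf y), norm_nonneg y, sq_nonneg (‖zOf y‖ - ‖y‖), sq_nonneg (‖zOf y‖ + ‖y‖)]

/-- `zOf y ≠ 0` for `y ≠ 0`. -/
theorem zOf_ne_zero {y : E2} (hy : y ≠ 0) : zOf y ≠ 0 := by
  rw [← norm_ne_zero_iff, norm_zOf, norm_ne_zero_iff]; exact hy

/-- Real part of `zOf y` is the first coordinate. -/
theorem zOf_re (y : E2) : (zOf y).re = y 0 := by simp [zOf]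

/-- Imaginary part of `zOf y` is the second coordinate. -/
theorem zOf_im (y : E2) : (zOf y).im = y 1 := by simp [zOf]

/-- A point of the plane is recovered from its modulus and the direction `e^{iψ} = zOf y / ‖y‖`. -/
theorem eq_of_exp_mul_I {y : E2} (hy : y ≠ 0) {ψ : ℝ}
    (h : Complex.exp ((ψ : ℂ) * I) = zOf y * ((‖y‖ : ℝ) : ℂ)⁻¹) :
    ‖y‖ • (!₂[Real.cos ψ, Real.sin ψ] : E2) = y := by
  have hn : (‖y‖ : ℝ) ≠ 0 := norm_ne_zero_iff.2 hy
  have hre := congrArg Complex.re h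
  have him := congrArg Complex.im h
  rw [Complex.exp_ofReal_mul_I_re] at hre
  rw [Complex.exp_ofReal_mul_I_im] at him
  simp only [Complex.mul_re, Complex.mul_im, Complex.inv_re, Complex.inv_im, Complex.ofReal_re,
    Complex.ofReal_im, Complex.normSq_ofReal, zOf_re, zOf_im] at hre him
  ext i
  fin_cases i
  · simp only [PiLp.smul_apply, smul_eq_mul, Fin.zero_eta, Matrix.cons_val_zero]
    show ‖y‖ * Real.cos ψ = y 0
    rw [hre]; field_simp; ring
  · simp only [PiLp.smul_apply, smul_eq_mul, Fin.mk_one, Matrix.cons_val_one, Matrix.cons_val_zero]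
    show ‖y‖ * Real.sin ψ = y 1
    rw [him]; field_simp; ring

/-- `Epol ∘ polarLogAt φ₀ = id` off the origin, for every branch `φ₀`. -/
theorem Epol_polarLogAt (hlam : 1 < lam) (φ₀ : ℝ) {y : E2} (hy : y ≠ 0) :
    Epol lam (polarLogAt lam φ₀ y) = y := by
  have hn : 0 < ‖y‖ := norm_pos_iff.2 hy
  rw [Epol, polarLogAt]
  simp only
  rw [mul_div_cancel_left₀ _ (kap_ne_zero hlam), Real.exp_log hn]
  apply eq_of_exp_mul_I hy
  set w := zOf y * Complex.exp (-((φ₀ : ℂ) * I)) with hw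
  have hwn : ‖w‖ = ‖y‖ := by
    rw [hw, norm_mul, show -((φ₀ : ℂ) * I) = ((-φ₀ : ℝ) : ℂ) * I by push_cast; ring,
      Complex.norm_exp_ofReal_mul_I, mul_one, norm_zOf]
  have key := Complex.norm_mul_exp_arg_mul_I w
  rw [hwn] at key
  have hn' : ((‖y‖ : ℝ) : ℂ) ≠ 0 := Complex.ofReal_ne_zero.2 hn.ne'
  rw [Complex.ofReal_add, add_mul, Complex.exp_add, eq_mul_inv_iff_mul_eq₀ hn']
  calc Complex.exp ((φ₀ : ℂ) * I) * Complex.exp ((Complex.arg w : ℂ) * I) * (‖y‖ : ℂ)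
      = Complex.exp ((φ₀ : ℂ) * I) * ((‖y‖ : ℂ) * Complex.exp ((Complex.arg w : ℂ) * I)) := by ring
    _ = Complex.exp ((φ₀ : ℂ) * I) * w := by rw [key]
    _ = zOf y := by
      rw [hw, mul_left_comm, ← Complex.exp_add, show (φ₀ : ℂ) * I + -((φ₀ : ℂ) * I) = 0 by ring,
        Complex.exp_zero, mul_one]

/-- `Epol ∘ polarLog = id` off the origin. -/
theorem Epol_polarLog (hlam : 1 < lam) {y : E2} (hy : y ≠ 0) : Epol lam (polarLog lam y) = y := by
  have h := Epol_polarLogAt hlam 0 hy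
  rw [polarLogAt] at h
  simp only [Complex.ofReal_zero, zero_mul, neg_zero, Complex.exp_zero, mul_one, zero_add] at h
  exact h

/-- The fibres of `Epol` over its own image: `polarLog (Epol x) = x + (0, 2πk)`. -/
theorem polarLog_Epol (hlam : 1 < lam) (x : ℝ × ℝ) :
    ∃ k : ℤ, polarLog lam (Epol lam x) = x + (0, 2 * Real.pi * k) := by
  refine ⟨-toIocDiv Real.two_pi_pos (-Real.pi) x.2, ?_⟩
  rw [polarLog, norm_Epol, Real.log_exp, mul_div_cancel₀ _ (kap_ne_zero hlam), zOf_Epol,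
    Complex.arg_real_mul _ (Real.exp_pos _), Complex.arg_exp_mul_I]
  refine Prod.ext (by simp) ?_
  show toIocMod Real.two_pi_pos (-Real.pi) x.2 = x.2 + 2 * Real.pi * ((-toIocDiv Real.two_pi_pos (-Real.pi) x.2 : ℤ) : ℝ)
  rw [← self_sub_toIocDiv_zsmul, zsmul_eq_mul]
  push_cast
  ring

/-- `Epol` is `2π`-periodic in the angle (integer multiples). -/
theorem Epol_add_right_int (x : ℝ × ℝ) (k : ℤ) : Epol lam (x + (0, 2 * Real.pi * k)) = Epol lam x := by
  simp only [Epol, Prod.fst_add, Prod.snd_add, add_zero]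
  rw [show x.2 + 2 * Real.pi * k = x.2 + k * (2 * Real.pi) by ring, Real.cos_add_int_mul_two_pi,
    Real.sin_add_int_mul_two_pi]

/-- One longitude turn upstairs is the deck homothety downstairs: `Epol (x + (2π, 0)) = λ Epol x`. -/
theorem Epol_add_left (hlam : 1 < lam) (x : ℝ × ℝ) : Epol lam (x + (2 * Real.pi, 0)) = lam • Epol lam x := by
  have hl : 0 < lam := lt_trans zero_lt_one hlam
  simp only [Epol, Prod.fst_add, Prod.snd_add, add_zero, smul_smul]
  congr 1
  rw [add_div, Real.exp_add, show (2 * Real.pi) / kap lam = Real.log lam by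
    rw [kap]; field_simp, Real.exp_log hl, mul_comm]

variable {τV : (𝓡∂ 3).boundary RoundSolidTorus ≃ₘ⟮𝓡 2, 𝓡 2⟯ (𝓡∂ 3).boundary RoundSolidTorus}

variable (lam) in
/-- **The planar lift** `τ̂ = Epol ∘ F̃ ∘ Epol⁻¹` of the boundary diffeomorphism, extended by
`0 ↦ 0`. -/
def tauHat (hτ : τV basePt = basePt) (y : E2) : E2 :=
  if y = 0 then 0 else Epol lam (liftT hτ (polarLog lam y))

/-- `τ̂ 0 = 0` by definition. -/
theorem tauHat_zero (hτ : τV basePt = basePt) : tauHat lam hτ 0 = 0 := by simp [tauHat]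

/-- Off the origin `τ̂ = Epol ∘ liftT ∘ polarLog`. -/
theorem tauHat_of_ne (hτ : τV basePt = basePt) {y : E2} (hy : y ≠ 0) :
    tauHat lam hτ y = Epol lam (liftT hτ (polarLog lam y)) := by simp [tauHat, hy]

/-- `τ̂ y ≠ 0` for `y ≠ 0`. -/
theorem tauHat_ne_zero (hτ : τV basePt = basePt) {y : E2} (hy : y ≠ 0) : tauHat lam hτ y ≠ 0 := by
  rw [tauHat_of_ne hτ hy]; exact Epol_ne_zero _

/-- `τ̂ ∘ Epol = Epol ∘ F̃` (well-definedness of the planar lift). -/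
theorem tauHat_Epol (hlam : 1 < lam) (hτ : τV basePt = basePt)
    (h : ∀ γ, FundamentalGroup.mapOfEq (⟨τV, τV.continuous⟩ : C(_, _)) hτ γ = γ) (x : ℝ × ℝ) :
    tauHat lam hτ (Epol lam x) = Epol lam (liftT hτ x) := by
  rw [tauHat_of_ne hτ (Epol_ne_zero x)]
  obtain ⟨k, hk⟩ := polarLog_Epol hlam x
  rw [hk, liftT_add_right_int hτ h, Epol_add_right_int]

/-- **`τ̂` commutes with the deck homothety.** -/
theorem tauHat_smul (hlam : 1 < lam) (hτ : τV basePt = basePt)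
    (h : ∀ γ, FundamentalGroup.mapOfEq (⟨τV, τV.continuous⟩ : C(_, _)) hτ γ = γ) (y : E2) :
    tauHat lam hτ (lam • y) = lam • tauHat lam hτ y := by
  by_cases hy : y = 0
  · simp [hy, tauHat_zero]
  · conv_lhs => rw [← Epol_polarLog hlam hy, ← Epol_add_left hlam]
    rw [tauHat_Epol hlam hτ h, liftT_add_left hτ h, Epol_add_left hlam, ← tauHat_Epol hlam hτ h,
      Epol_polarLog hlam hy]

/-- Uniqueness of lifts through `cT`, general form. -/
theorem eq_of_cT_eq {G₁ G₂ : ℝ × ℝ → ℝ × ℝ} (h₁ : Continuous G₁) (h₂ : Continuous G₂)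
    (he : ∀ x, cT (G₁ x) = cT (G₂ x)) {x₀ : ℝ × ℝ} (h0 : G₁ x₀ = G₂ x₀) : G₁ = G₂ := by
  have e1 : (fun x => (G₁ x).1) = fun x => (G₂ x).1 :=
    isCoveringMap_angle.eq_of_comp_eq (continuous_fst.comp h₁) (continuous_fst.comp h₂)
      (funext fun x => congrArg Prod.fst (he x)) x₀ (congrArg Prod.fst h0)
  have e2 : (fun x => (G₁ x).2) = fun x => (G₂ x).2 :=
    isCoveringMap_angle.eq_of_comp_eq (continuous_snd.comp h₁) (continuous_snd.comp h₂)
      (funext fun x => congrArg Prod.snd (he x)) x₀ (congrArg Prod.snd h0)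
  funext x
  exact Prod.ext (congrFun e1 x) (congrFun e2 x)

/-- The lifts of mutually inverse boundary diffeomorphisms are mutually inverse. -/
theorem liftT_liftT {τA τB : (𝓡∂ 3).boundary RoundSolidTorus ≃ₘ⟮𝓡 2, 𝓡 2⟯ (𝓡∂ 3).boundary RoundSolidTorus}
    (hA : τA basePt = basePt) (hB : τB basePt = basePt) (hBA : ∀ z, τB (τA z) = z) (x : ℝ × ℝ) :
    liftT hB (liftT hA x) = x := by
  have key : (fun x => liftT hB (liftT hA x)) = id := by
    refine eq_of_cT_eq ((continuous_liftT hB).comp (continuous_liftT hA)) continuous_id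
      (fun x => ?_) (x₀ := (0, 0)) (by simp [liftT_zero])
    rw [cT_liftT, cT_liftT, angMap_apply, angMap_apply, Homeomorph.symm_apply_apply, hBA,
      Homeomorph.apply_symm_apply]; rfl
  exact congrFun key x

/-- **`τ̂⁻¹ ∘ τ̂ = id`** for the lifts of `τ⁻¹` and `τ`. -/
theorem tauHat_tauHat (hlam : 1 < lam)
    {τA τB : (𝓡∂ 3).boundary RoundSolidTorus ≃ₘ⟮𝓡 2, 𝓡 2⟯ (𝓡∂ 3).boundary RoundSolidTorus}
    (hA : τA basePt = basePt) (hB : τB basePt = basePt)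
    (hBtriv : ∀ γ, FundamentalGroup.mapOfEq (⟨τB, τB.continuous⟩ : C(_, _)) hB γ = γ)
    (hBA : ∀ z, τB (τA z) = z) (y : E2) :
    tauHat lam hB (tauHat lam hA y) = y := by
  by_cases hy : y = 0
  · simp [hy, tauHat_zero]
  · rw [tauHat_of_ne hA hy, tauHat_Epol hlam hB hBtriv, liftT_liftT hA hB hBA, Epol_polarLog hlam hy]

/-- `π₁`-triviality passes to the inverse diffeomorphism. -/
theorem mapOfEq_symm_eq (hτ : τV basePt = basePt)
    (h : ∀ γ, FundamentalGroup.mapOfEq (⟨τV, τV.continuous⟩ : C(_, _)) hτ γ = γ)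
    (hτ' : τV.symm basePt = basePt)
    (γ : FundamentalGroup ((𝓡∂ 3).boundary RoundSolidTorus) basePt) :
    FundamentalGroup.mapOfEq (⟨τV.symm, τV.symm.continuous⟩ : C(_, _)) hτ' γ = γ := by
  conv_lhs => rw [← h γ]
  rw [← FundamentalGroup.mapOfEq_comp_apply]
  exact FundamentalGroup.mapOfEq_apply_eq_self_of_forall_eq _ (fun z => τV.symm_apply_apply z) γ

/-- The inverse of a basepoint-preserving diffeomorphism preserves the base point. -/
theorem symm_basePt (hτ : τV basePt = basePt) : τV.symm basePt = basePt := by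
  rw [← hτ, Diffeomorph.symm_apply_apply, hτ]

/-! #### The lift property over `∂V` -/

/-- The boundary point of `∂V` under `Epol x`: `incl (bdry⁻¹ (cT x)) = P (Epol x, 0)`. -/
theorem covMap_Epol (hlam : 1 < lam) (x : ℝ × ℝ) :
    covMap lam (Epol lam x, 0) =
      RegularSublevel.incl isRegularLevel_fn (boundaryHomeomorphAddCircle.symm (cT x)).1 := by
  have hE : Epol lam x ≠ 0 := Epol_ne_zero x
  have hp : ((Epol lam x, (0 : ℝ)) : E2 × ℝ) ∈ Hpunct := ⟨le_rfl, fun h => hE (congrArg Prod.fst h)⟩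
  have htp : RegularSublevel.incl isRegularLevel_fn (boundaryHomeomorphAddCircle.symm (cT x)).1 =
      torusParam 4 1 (1 / 4) ((x.1 : Real.Angle), (x.2 : Real.Angle)) :=
    incl_boundaryHomeomorphAngle_symm _
  rw [htp]
  have hv1 : 0 < (covMap lam (Epol lam x, 0)) 0 ^ 2 + (covMap lam (Epol lam x, 0)) 1 ^ 2 :=
    lt_of_lt_of_le (by norm_num) (three_le_sq_add_sq_of_G_nonpos (G_covMap_nonpos hp))
  have hv2 := torusParam_sq_add_sq_pos ((x.1 : Real.Angle), (x.2 : Real.Angle))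
  rw [← ptOf_longC_merC hv1, ← ptOf_longC_merC hv2, longC_covMap hp, merC_covMap hp,
    longC_torusParam, merC_torusParam]
  congr 1
  · -- longitude: `e^{i κ log ‖Epol x‖} = e^{i x.1}`
    rw [lngC, lng, show rad (Epol lam x, (0 : ℝ)) = ‖Epol lam x‖ by simp [rad, Real.sqrt_sq (norm_nonneg _)],
      norm_Epol, Real.log_exp, mul_div_cancel₀ _ (kap_ne_zero hlam)]
    simp [Real.Angle.toCircle_coe, Circle.coe_exp]
  · -- meridian: `w₀ + i w₁ = e^{i x.2}` for the unit vector `(cos x.2, sin x.2)`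
    have hw : (αinv (Epol lam x, (0 : ℝ))).2 = (!₂[Real.cos x.2, Real.sin x.2] : E2) := by
      simp only [αinv, add_zero]
      rw [show rad (Epol lam x, (0 : ℝ)) = ‖Epol lam x‖ by simp [rad, Real.sqrt_sq (norm_nonneg _)],
        norm_Epol, Epol, smul_smul, inv_mul_cancel₀ (Real.exp_pos _).ne', one_smul]
    rw [merW, hw]
    simp [Real.Angle.toCircle_coe, Circle.coe_exp, Complex.exp_mul_I]

/-- **The lift property**: `τ̂` covers `τ` through `P` on the boundary plane. -/
theorem hlift_tauHat (hlam : 1 < lam) (hτ : τV basePt = basePt)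
    (h : ∀ γ, FundamentalGroup.mapOfEq (⟨τV, τV.continuous⟩ : C(_, _)) hτ γ = γ)
    {y : E2} (hy : y ≠ 0) (z : (𝓡∂ 3).boundary RoundSolidTorus)
    (hz : RegularSublevel.incl isRegularLevel_fn z.1 = covMap lam (y, 0)) :
    RegularSublevel.incl isRegularLevel_fn (τV z).1 = covMap lam (tauHat lam hτ y, 0) := by
  set x := polarLog lam y with hx
  have hyx : Epol lam x = y := Epol_polarLog hlam hy
  rw [← hyx, covMap_Epol hlam] at hz
  have hz' : z = boundaryHomeomorphAddCircle.symm (cT x) :=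
    Subtype.ext (RegularSublevel.injective_incl isRegularLevel_fn hz)
  rw [hz', ← symm_angMap, ← cT_liftT hτ, ← covMap_Epol hlam, ← tauHat_Epol hlam hτ h, hyx]

end Planar

end Lift

end HomothetyCover

end Summit.SmoothPoincare4.SmoothPoincare4.Theorems

end
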